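import Mathlib
import HarnessLib
import Summits.HubbardSuperconductivity.HubbardSuperconductivity.Theorems.KLProgrammeKLRegimeEngineFrameShiftResponseFourLegSupport

/-!
# Route `KLProgramme` — ENGINE item stmt-HubbardSuperconductivity-20437 `KLRegimeEngineV17F2`, stub (c) `hshift` producer: the TREE share needs the two-leg
# size ON THE BAND SHELL ONLY (located risk #6b, tree half; cell gate-hubbard-kl, seat p2 g24)

WHY.  In the four-leg frame response the tree (pairing) term is `4·Σ_i ‖ṡ(X_i)‖·‖𝒲₂(X̄_i, X_i)‖·‖𝒲₄(X)‖` (p670081 `covRespCT_norm_kernel_four_pairing_le`):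
the symbol defect is read AT THE EXTERNAL LEGS, and `ṡ(X_i) = 0` unless the leg sits on the scale-`n` band shell `|e_{K₁}(k⃗_i)| < 5Λ_n/4`
(`mismatchDefect_eq_zero_of_band_ge`).  p670081/p670471 asked a flat two-leg size `S` at all four legs; with `S^V ≍ U` (a leg anywhere in the bare ball)
the tree share is `∝ U²·fd/Λ_n²`, one power of `Λ_n` short, exactly like the loop share (#6b).  On the shell the renormalised two-leg kernel is
`≍ U·Λ_n`-small (the flow frame cancels the self-energy on the Fermi curve), which restores the power — so the door must ask `S` ON-SHELL ONLY:
* §1 **`covRespCT_norm_kernel_four_sub_le_prod`** — the covariance response with a PER-LEG product hypothesis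
  `‖(s₁−s₀)(X_i)‖·‖𝒲_{t,2}(X̄_i, X_i)‖ ≤ P_i`: `‖𝒲′[s₁]₄(X) − 𝒲′[s₀]₄(X)‖ ≤ 30·(Σ_p‖s₁−s₀‖)·N₆ + 2·(Σ_i P_i)·N₄`;
* §2 **`covRespCT_norm_kernel_four_mismatch_sub_le_shell`** — mismatch form with the abstract ℓ¹ rate `σ₁` and `S` asked only at legs with
  `|e_{K₁}(k⃗_i)| < 5Λ/4`: `≤ 30·(σ₁·fd)·N₆ + 8·(βL²(200+200B₁)/Λ²·fd)·S·N₄`;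
* §3 **`norm_kernel_four_klEffectiveAction_frame_sub_le_shell`**, **`norm_klPairAmplitude_frame_sub_le_priced₁_shell`** — the kernel / pair-amplitude
  forms (dressing priced, `N₄′` priced by `A₄ ≥ ‖𝒞_n[K₂](Q;k,k′)‖`):
  `‖𝒞_n[K₂] − 𝒞_n[K₁]‖ ≤ ((6075/2)·A₄/Λ_n + 24(|β|L²)³·(30·σ₁·N₆ + 8·βL²(200+200B₁)/Λ_n²·S·N₄))·frameDist K₂ K₁` with `S` ON-SHELL.
With the support-resolved `σ₁` (…FourLegSupport) every share of the (c) response now has its natural power of `Λ_n`: dressing `∝ A₄·fd/Λ_n`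
(first order, `hshift_of_frameResponse_orders`' `ℓ₁`), loop `≈ (3200/π)B₁·C_band·N₆^V·fd` with `N₆^V ≲ c₆(KlamU)²/Λ_n`, tree `1600B₁·S_sh^V·N₄^V·fd/Λ_n²` with
`S_sh^V ≲ s·U·Λ_n`, `N₄^V ≲ Klam·U` (pencil, vertexFn units).  Proofs only; no definitions; sizes are hypotheses; nothing here asserts (c), any stub of 20437, K3,
the margin or superconductivity.  References: BGM 2006 §2.2–2.3 (2.21)–(2.28) [cite: BenfattoGiulianiMastropietro2006]; Salmhofer 1998 §3.1 [cite: Salmhofer1998].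
-/

noncomputable section

namespace Summit.HubbardSuperconductivity.HubbardSuperconductivity.Theorems.EngineV8

set_option linter.dupNamespace false -- summit = problem name (single-conjunct summit), D-0017

open Finset Literature.MathematicalPhysics.QuantumLattice Literature.Probability.LatticeModels GrassmannAlgebra
open Summit.HubbardSuperconductivity.HubbardSuperconductivity.Theorems.TwoPointAssembly
open Summit.HubbardSuperconductivity.HubbardSuperconductivity.Theorems.TwoVolumeDefect
open Summit.HubbardSuperconductivity.HubbardSuperconductivity.Theorems.KLRegimeSplit
open Summit.HubbardSuperconductivity.HubbardSuperconductivity.Theorems.KLProgrammeLegKernels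

variable {L M : ℕ} [NeZero L] [NeZero M]

/-! ## §1 The covariance response with a per-leg product hypothesis -/

omit [NeZero M] in
/-- **THE COVARIANCE RESPONSE OF THE FOUR-LEG KERNEL OF `𝒲′` AT ONE STRING, PER-LEG TREE HYPOTHESIS** (vertex `V_U + 𝒩_K`; Polchinski interpolation,
mean-value form): as `covRespCT_norm_kernel_four_sub_le` with the tree data per leg, `‖(s₁ − s₀)(X_i)‖·‖𝒲_{t,2}(X̄_i, X_i)‖ ≤ P_i`:
`‖𝒲′[s₁]₄(X) − 𝒲′[s₀]₄(X)‖ ≤ 30·(Σ_p ‖(s₁−s₀) p‖)·N₆ + 2·(Σ_i P_i)·N₄`. [cite: Salmhofer1998, §3.1 Prop. 1] -/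
theorem covRespCT_norm_kernel_four_sub_le_prod (s₀ s₁ : FreqMomentum L M × Fin 2 → ℂ) (β U : ℝ) (K : TrigPolyC4v)
    (X : Fin 4 → HubbardFieldIdx L M)
    (hZ : ∀ t ∈ Set.Icc (0 : ℝ) 1, effPartitionFn ℂ (normalCovariance L M s₀ + ((t : ℂ)) • (normalCovariance L M s₁ - normalCovariance L M s₀))
      (hubbardInteraction L M β U + counterQuadratic L M β K) ≠ 0)
    {N₆ N₄ : ℝ} {P : Fin 4 → ℝ}
    (hN6 : ∀ t ∈ Set.Icc (0 : ℝ) 1, ∀ A : HubbardFieldIdx L M,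
      ‖kernel ℂ (effAction ℂ (normalCovariance L M s₀ + ((t : ℂ)) • (normalCovariance L M s₁ - normalCovariance L M s₀))
        (hubbardInteraction L M β U + counterQuadratic L M β K)) 6 (Fin.snoc (Fin.snoc X (A.1, 1 - A.2) : Fin 5 → HubbardFieldIdx L M) A)‖ ≤ N₆)
    (hP : ∀ t ∈ Set.Icc (0 : ℝ) 1, ∀ i : Fin 4,
      ‖s₁ (X i).1 - s₀ (X i).1‖ *
        ‖kernel ℂ (effAction ℂ (normalCovariance L M s₀ + ((t : ℂ)) • (normalCovariance L M s₁ - normalCovariance L M s₀))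
          (hubbardInteraction L M β U + counterQuadratic L M β K)) 2 ![(((X i).1, 1 - (X i).2) : HubbardFieldIdx L M), X i]‖ ≤ P i)
    (hN4 : ∀ t ∈ Set.Icc (0 : ℝ) 1,
      ‖kernel ℂ (effAction ℂ (normalCovariance L M s₀ + ((t : ℂ)) • (normalCovariance L M s₁ - normalCovariance L M s₀))
        (hubbardInteraction L M β U + counterQuadratic L M β K)) 4 X‖ ≤ N₄) :
    ‖kernel ℂ (effAction ℂ (normalCovariance L M s₁) (hubbardInteraction L M β U + counterQuadratic L M β K)) 4 X -
        kernel ℂ (effAction ℂ (normalCovariance L M s₀) (hubbardInteraction L M β U + counterQuadratic L M β K)) 4 X‖ ≤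
      30 * (∑ p, ‖s₁ p - s₀ p‖) * N₆ + 2 * (∑ i, P i) * N₄ := by
  classical
  letI : LinearOrder (HubbardFieldIdx L M) := LinearOrder.lift' (Fintype.equivFin _) (Fintype.equivFin _).injective
  let Φ : HubbardGrassmann L M →ₗ[ℂ] ℂ :=
    { toFun := fun F => kernel ℂ F 4 X
      map_add' := fun F G => kernel_add ℂ F G 4 X
      map_smul' := fun c F => by rw [kernel_smul, RingHom.id_apply, smul_eq_mul] }
  have hΦ1 : Φ 1 = 0 := by
    show kernel ℂ (1 : HubbardGrassmann L M) 4 X = 0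
    rw [kernel_def, iterDeriv_succ_apply, grassmannDeriv_one, map_zero, map_zero, mul_zero]
  have hV0 := constPart_hubbardInteraction_add_counterQuadratic (L := L) (M := M) β U K
  have hVe : hubbardInteraction L M β U + counterQuadratic L M β K ∈ evenOdd ℂ (ι := HubbardFieldIdx L M) 0 :=
    hubbardInteraction_add_counterQuadratic_mem_evenOdd_zero β U K
  refine norm_apply_effAction_sub_le_of_linePath (normalCovariance L M s₀) (normalCovariance L M s₁) hV0 hVe hZ Φ hΦ1 ?_
  intro t ht
  have hNt := hN6 t ht
  have hPt := hP t ht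
  have hN4t := hN4 t ht
  rw [normalCovariance_linePath, normalCovariance_sub]
  rw [normalCovariance_linePath] at hNt hPt hN4t
  set st : FreqMomentum L M × Fin 2 → ℂ := fun p => s₀ p + (t : ℂ) * (s₁ p - s₀ p) with hst
  set W := effAction ℂ (normalCovariance L M st) (hubbardInteraction L M β U + counterQuadratic L M β K) with hW
  have hloop : ‖Φ (grassmannLaplacian ℂ (normalCovariance L M fun p => s₁ p - s₀ p) W)‖ ≤ 30 * (∑ p, ‖s₁ p - s₀ p‖) * N₆ :=
    covResp_norm_kernel_four_laplacian_le (fun p => s₁ p - s₀ p) W X hNt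
  have htree : ‖Φ (grassmannDerivPairing ℂ (normalCovariance L M fun p => s₁ p - s₀ p) W W)‖ ≤
      4 * (∑ i : Fin 4, ‖s₁ (X i).1 - s₀ (X i).1‖ *
          ‖kernel ℂ W 2 ![(((X i).1, 1 - (X i).2) : HubbardFieldIdx L M), X i]‖) * ‖kernel ℂ W 4 X‖ :=
    covRespCT_norm_kernel_four_pairing_le (fun p => s₁ p - s₀ p) st β U K X
  have hsum : ∑ i : Fin 4, ‖s₁ (X i).1 - s₀ (X i).1‖ *
      ‖kernel ℂ W 2 ![(((X i).1, 1 - (X i).2) : HubbardFieldIdx L M), X i]‖ ≤ ∑ i, P i := sum_le_sum fun i _ => hPt i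
  have hP0 : 0 ≤ ∑ i, P i := le_trans (sum_nonneg fun i _ => mul_nonneg (norm_nonneg _) (norm_nonneg _)) hsum
  have htree' : ‖Φ (grassmannDerivPairing ℂ (normalCovariance L M fun p => s₁ p - s₀ p) W W)‖ ≤ 4 * (∑ i, P i) * N₄ :=
    htree.trans (mul_le_mul (mul_le_mul_of_nonneg_left hsum (by norm_num)) hN4t (norm_nonneg _) (mul_nonneg (by norm_num) hP0))
  calc ‖Φ (grassmannLaplacian ℂ (normalCovariance L M fun p => s₁ p - s₀ p) W) -
        (2 : ℂ)⁻¹ * Φ (grassmannDerivPairing ℂ (normalCovariance L M fun p => s₁ p - s₀ p) W W)‖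
      ≤ ‖Φ (grassmannLaplacian ℂ (normalCovariance L M fun p => s₁ p - s₀ p) W)‖ +
          ‖(2 : ℂ)⁻¹ * Φ (grassmannDerivPairing ℂ (normalCovariance L M fun p => s₁ p - s₀ p) W W)‖ := norm_sub_le _ _
    _ ≤ 30 * (∑ p, ‖s₁ p - s₀ p‖) * N₆ + 2 * (∑ i, P i) * N₄ := by
      refine add_le_add hloop ?_
      rw [norm_mul, norm_inv, RCLike.norm_ofNat]
      calc (2 : ℝ)⁻¹ * ‖Φ (grassmannDerivPairing ℂ (normalCovariance L M fun p => s₁ p - s₀ p) W W)‖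
          ≤ 2⁻¹ * (4 * (∑ i, P i) * N₄) := mul_le_mul_of_nonneg_left htree' (by norm_num)
        _ = 2 * (∑ i, P i) * N₄ := by ring

/-! ## §2 The mismatch form: ℓ¹ rate `σ₁`, two-leg size ON THE BAND SHELL only -/

omit [NeZero M] in
/-- **THE FOUR-LEG MISMATCH RESPONSE AT ONE STRING, ℓ¹ RATE + ON-SHELL TREE**: `s₀ = Ψ_{K₁}`, `s₁ = Ψ̃`, `frameDist K₂ K₁ ≤ Λ/4`,
`Σ_p ‖Ψ̃(p) − Ψ_{K₁}(p)‖ ≤ σ₁·fd`, six-leg kernels `≤ N₆`, four-leg kernel `≤ N₄`, and the two-leg kernels `≤ S` ONLY at the legs on the band shell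
`|e_{K₁}(k⃗_i)| < 5Λ/4` (elsewhere `ṡ(X_i) = 0`): `‖𝒲′[Ψ̃]₄(X) − 𝒲′[Ψ_{K₁}]₄(X)‖ ≤ 30·(σ₁·fd)·N₆ + 8·(βL²(200+200B₁)/Λ²·fd)·S·N₄`.
[cite: BenfattoGiulianiMastropietro2006, §2.3 (2.21)–(2.24)] -/
theorem covRespCT_norm_kernel_four_mismatch_sub_le_shell {β : ℝ} (hβ : 0 < β) {B₁ : ℝ} (hB0 : 0 ≤ B₁) (hB : ∀ y, |deriv salmhoferCutoff y| ≤ B₁)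
    {Λ : ℝ} (hΛ : 0 < Λ) (μ U : ℝ) (K₁ K₂ : TrigPolyC4v) (hfd : frameDist K₂ K₁ ≤ Λ / 4) {s₀ s₁ : FreqMomentum L M × Fin 2 → ℂ}
    (hs₀ : s₀ = uvSymbolCT L M β μ K₁ Λ)
    (hs₁ : s₁ = fun ks => uvSymbolCT L M β μ K₂ Λ ks /
      (1 + uvSymbolCT L M β μ K₂ Λ ks * (((fsub K₂ K₁).eval (latticeMomentum L ks.1.2) / (β * (L : ℝ) ^ 2) : ℝ) : ℂ)))
    {σ₁ : ℝ} (hσ : ∑ p, ‖s₁ p - s₀ p‖ ≤ σ₁ * frameDist K₂ K₁)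
    (X : Fin 4 → HubbardFieldIdx L M)
    (hZ : ∀ t ∈ Set.Icc (0 : ℝ) 1, effPartitionFn ℂ (normalCovariance L M s₀ + ((t : ℂ)) • (normalCovariance L M s₁ - normalCovariance L M s₀))
      (hubbardInteraction L M β U + counterQuadratic L M β K₁) ≠ 0)
    {N₆ S N₄ : ℝ} (hS0 : 0 ≤ S)
    (hN6 : ∀ t ∈ Set.Icc (0 : ℝ) 1, ∀ A : HubbardFieldIdx L M,
      ‖kernel ℂ (effAction ℂ (normalCovariance L M s₀ + ((t : ℂ)) • (normalCovariance L M s₁ - normalCovariance L M s₀))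
        (hubbardInteraction L M β U + counterQuadratic L M β K₁)) 6 (Fin.snoc (Fin.snoc X (A.1, 1 - A.2) : Fin 5 → HubbardFieldIdx L M) A)‖ ≤ N₆)
    (hS : ∀ t ∈ Set.Icc (0 : ℝ) 1, ∀ i : Fin 4, |nambuXiCT L μ K₁ (X i).1.1.2| < 5 * Λ / 4 →
      ‖kernel ℂ (effAction ℂ (normalCovariance L M s₀ + ((t : ℂ)) • (normalCovariance L M s₁ - normalCovariance L M s₀))
        (hubbardInteraction L M β U + counterQuadratic L M β K₁)) 2 ![(((X i).1, 1 - (X i).2) : HubbardFieldIdx L M), X i]‖ ≤ S)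
    (hN4 : ∀ t ∈ Set.Icc (0 : ℝ) 1,
      ‖kernel ℂ (effAction ℂ (normalCovariance L M s₀ + ((t : ℂ)) • (normalCovariance L M s₁ - normalCovariance L M s₀))
        (hubbardInteraction L M β U + counterQuadratic L M β K₁)) 4 X‖ ≤ N₄) :
    ‖kernel ℂ (effAction ℂ (normalCovariance L M s₁) (hubbardInteraction L M β U + counterQuadratic L M β K₁)) 4 X -
        kernel ℂ (effAction ℂ (normalCovariance L M s₀) (hubbardInteraction L M β U + counterQuadratic L M β K₁)) 4 X‖ ≤
      30 * (σ₁ * frameDist K₂ K₁) * N₆ + 8 * (β * (L : ℝ) ^ 2 * (200 + 200 * B₁) / Λ ^ 2 * frameDist K₂ K₁) * S * N₄ := by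
  classical
  have hL : (0 : ℝ) < L := by exact_mod_cast NeZero.pos L
  have hfd0 : 0 ≤ frameDist K₂ K₁ := frameDist_nonneg K₂ K₁
  have hD : ∀ kv : TorusSite 2 L, |(fsub K₂ K₁).eval (latticeMomentum L kv)| ≤ frameDist K₂ K₁ := fun kv => by
    rw [eval_fsub]; exact abs_eval_sub_le_frameDist K₂ K₁ _
  set r : ℝ := β * (L : ℝ) ^ 2 * (200 + 200 * B₁) / Λ ^ 2 * frameDist K₂ K₁ with hr
  have hr0 : 0 ≤ r := by positivity
  -- per-leg products: `r·S` on the shell, `0` off it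
  have hP : ∀ t ∈ Set.Icc (0 : ℝ) 1, ∀ i : Fin 4,
      ‖s₁ (X i).1 - s₀ (X i).1‖ *
        ‖kernel ℂ (effAction ℂ (normalCovariance L M s₀ + ((t : ℂ)) • (normalCovariance L M s₁ - normalCovariance L M s₀))
          (hubbardInteraction L M β U + counterQuadratic L M β K₁)) 2 ![(((X i).1, 1 - (X i).2) : HubbardFieldIdx L M), X i]‖ ≤ r * S := by
    intro t ht i
    by_cases hsh : |nambuXiCT L μ K₁ (X i).1.1.2| < 5 * Λ / 4
    · have hDi : ‖s₁ (X i).1 - s₀ (X i).1‖ ≤ r := by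
        subst hs₀ hs₁
        have h := norm_mismatchDefect_le hβ μ K₁ K₂ Λ hB0 hB hΛ (X i).1.1.1 (X i).1.1.2 (X i).1.2 ((hD _).trans hfd)
        exact h.trans (mul_le_mul_of_nonneg_left (hD _) (by positivity))
      exact mul_le_mul hDi (hS t ht i hsh) (norm_nonneg _) hr0
    · have hzero : s₁ (X i).1 - s₀ (X i).1 = 0 := by
        subst hs₀ hs₁
        exact mismatchDefect_eq_zero_of_band_ge hβ μ K₁ K₂ hΛ (X i).1.1.1 (X i).1.1.2 (X i).1.2 ((hD _).trans hfd) (not_lt.1 hsh)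
      rw [hzero, norm_zero, zero_mul]
      positivity
  have h := covRespCT_norm_kernel_four_sub_le_prod s₀ s₁ β U K₁ X hZ hN6 hP hN4
  have hN60 : 0 ≤ N₆ := (norm_nonneg _).trans (hN6 0 ⟨le_rfl, zero_le_one⟩ (X 0))
  have hN40 : 0 ≤ N₄ := (norm_nonneg _).trans (hN4 0 ⟨le_rfl, zero_le_one⟩)
  refine h.trans (add_le_add ?_ (le_of_eq ?_))
  · exact mul_le_mul_of_nonneg_right (mul_le_mul_of_nonneg_left hσ (by norm_num)) hN60
  · simp only [Finset.sum_const, Finset.card_univ, Fintype.card_fin, nsmul_eq_mul]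
    push_cast
    ring

/-! ## §3 Kernel level and pair-amplitude level (dressing priced, `N₄′` priced, loop by `σ₁`, tree ON-SHELL) -/

/-- **THE FRAME-SHIFT RESPONSE OF THE SCALE-`n` FOUR-LEG KERNEL, ℓ¹ RATE + ON-SHELL TREE, DRESSING PRICED**:
`‖T_n(K₂)₄(X) − T_n(K₁)₄(X)‖ ≤ (600·fd/Λ_n)·N₄′ + 30·(σ₁·fd)·N₆ + 8·(βL²(200+200B₁)/Λ_n²·fd)·S·N₄`, `S` asked only at legs with `|e_{K₁}(k⃗_i)| < 5Λ_n/4`.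
[cite: BenfattoGiulianiMastropietro2006, §2.3 (2.21)–(2.24)] -/
theorem norm_kernel_four_klEffectiveAction_frame_sub_le_shell {β : ℝ} (hβ : 0 < β) {B₁ : ℝ} (hB0 : 0 ≤ B₁) (hB : ∀ y, |deriv salmhoferCutoff y| ≤ B₁)
    (U μ : ℝ) (K₁ K₂ : TrigPolyC4v) (n : ℕ) (hfd : frameDist K₂ K₁ ≤ klScale klE0 n / 4)
    (hZ₂ : effPartitionFn ℂ (normalCovariance L M (uvSymbolCT L M β μ K₂ (klScale klE0 n)))
      (hubbardInteraction L M β U + counterQuadratic L M β K₂) ≠ 0)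
    {s₀ s₁ : FreqMomentum L M × Fin 2 → ℂ} (hs₀ : s₀ = uvSymbolCT L M β μ K₁ (klScale klE0 n))
    (hs₁ : s₁ = fun ks => uvSymbolCT L M β μ K₂ (klScale klE0 n) ks /
      (1 + uvSymbolCT L M β μ K₂ (klScale klE0 n) ks * (((fsub K₂ K₁).eval (latticeMomentum L ks.1.2) / (β * (L : ℝ) ^ 2) : ℝ) : ℂ)))
    {σ₁ : ℝ} (hσ : ∑ p, ‖s₁ p - s₀ p‖ ≤ σ₁ * frameDist K₂ K₁)
    (X : Fin 4 → HubbardFieldIdx L M) {N₄' N₆ S N₄ : ℝ}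
    (hN4' : ‖kernel ℂ (effAction ℂ (normalCovariance L M s₁) (hubbardInteraction L M β U + counterQuadratic L M β K₁)) 4 X‖ ≤ N₄')
    (hZ : ∀ t ∈ Set.Icc (0 : ℝ) 1, effPartitionFn ℂ (normalCovariance L M s₀ + ((t : ℂ)) • (normalCovariance L M s₁ - normalCovariance L M s₀))
      (hubbardInteraction L M β U + counterQuadratic L M β K₁) ≠ 0)
    (hN6 : ∀ t ∈ Set.Icc (0 : ℝ) 1, ∀ A : HubbardFieldIdx L M,
      ‖kernel ℂ (effAction ℂ (normalCovariance L M s₀ + ((t : ℂ)) • (normalCovariance L M s₁ - normalCovariance L M s₀))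
        (hubbardInteraction L M β U + counterQuadratic L M β K₁)) 6 (Fin.snoc (Fin.snoc X (A.1, 1 - A.2) : Fin 5 → HubbardFieldIdx L M) A)‖ ≤ N₆)
    (hS : ∀ t ∈ Set.Icc (0 : ℝ) 1, ∀ i : Fin 4, |nambuXiCT L μ K₁ (X i).1.1.2| < 5 * klScale klE0 n / 4 →
      ‖kernel ℂ (effAction ℂ (normalCovariance L M s₀ + ((t : ℂ)) • (normalCovariance L M s₁ - normalCovariance L M s₀))
        (hubbardInteraction L M β U + counterQuadratic L M β K₁)) 2 ![(((X i).1, 1 - (X i).2) : HubbardFieldIdx L M), X i]‖ ≤ S)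
    (hN4 : ∀ t ∈ Set.Icc (0 : ℝ) 1,
      ‖kernel ℂ (effAction ℂ (normalCovariance L M s₀ + ((t : ℂ)) • (normalCovariance L M s₁ - normalCovariance L M s₀))
        (hubbardInteraction L M β U + counterQuadratic L M β K₁)) 4 X‖ ≤ N₄) (hS0 : 0 ≤ S) :
    ‖kernel ℂ (klEffectiveAction L M β U μ K₂ klE0 n) 4 X - kernel ℂ (klEffectiveAction L M β U μ K₁ klE0 n) 4 X‖ ≤
      600 * frameDist K₂ K₁ / klScale klE0 n * N₄' +
        (30 * (σ₁ * frameDist K₂ K₁) * N₆ +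
          8 * (β * (L : ℝ) ^ 2 * (200 + 200 * B₁) / klScale klE0 n ^ 2 * frameDist K₂ K₁) * S * N₄) := by
  have hΛ : 0 < klScale klE0 n := klth_klScale_pos n
  have hmis := covRespCT_norm_kernel_four_mismatch_sub_le_shell hβ hB0 hB hΛ μ U K₁ K₂ hfd hs₀ hs₁ hσ X hZ hS0 hN6 hS hN4
  have hid := kernel_four_klEffectiveAction_frame_sub_eq hβ U μ K₁ K₂ n hZ₂ X
  have hm := norm_prod_dressing_sub_one_le hβ μ K₁ K₂ hΛ hfd X
  subst hs₀ hs₁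
  rw [hid]
  refine (norm_add_le _ _).trans (add_le_add ?_ hmis)
  rw [norm_mul]
  exact mul_le_mul hm hN4' (norm_nonneg _) ((norm_nonneg _).trans hm)

/-- **THE FRAME-SHIFT RESPONSE OF THE PAIR AMPLITUDE — FINAL p2 FORM** (dressing priced; `N₄′` priced by `A₄ ≥ ‖𝒞_n[K₂](Q;k,k′)‖`; loop by the ℓ¹ rate
`σ₁`; tree with the two-leg size `S` asked ONLY at pair-string legs on the band shell `|e_{K₁}(k⃗_i)| < 5Λ_n/4`):
`‖𝒞_n[K₂](Q;k,k′) − 𝒞_n[K₁](Q;k,k′)‖ ≤ ((6075/2)·A₄/Λ_n + 24(|β|L²)³·(30·σ₁·N₆ + 8·βL²(200+200B₁)/Λ_n²·S·N₄))·frameDist K₂ K₁`.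
[cite: BenfattoGiulianiMastropietro2006, §2.3 (2.21)–(2.24)] -/
theorem norm_klPairAmplitude_frame_sub_le_priced₁_shell {β : ℝ} (hβ : 0 < β) {B₁ : ℝ} (hB0 : 0 ≤ B₁) (hB : ∀ y, |deriv salmhoferCutoff y| ≤ B₁)
    (U μ : ℝ) (K₁ K₂ : TrigPolyC4v) (n : ℕ) (hfd : frameDist K₂ K₁ ≤ klScale klE0 n / 4)
    (hZ₂ : effPartitionFn ℂ (normalCovariance L M (uvSymbolCT L M β μ K₂ (klScale klE0 n)))
      (hubbardInteraction L M β U + counterQuadratic L M β K₂) ≠ 0)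
    {s₀ s₁ : FreqMomentum L M × Fin 2 → ℂ} (hs₀ : s₀ = uvSymbolCT L M β μ K₁ (klScale klE0 n))
    (hs₁ : s₁ = fun ks => uvSymbolCT L M β μ K₂ (klScale klE0 n) ks /
      (1 + uvSymbolCT L M β μ K₂ (klScale klE0 n) ks * (((fsub K₂ K₁).eval (latticeMomentum L ks.1.2) / (β * (L : ℝ) ^ 2) : ℝ) : ℂ)))
    {σ₁ : ℝ} (hσ : ∑ p, ‖s₁ p - s₀ p‖ ≤ σ₁ * frameDist K₂ K₁)
    (Q k k' : TorusSite 2 L) {A₄ N₆ S N₄ : ℝ}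
    (hC4 : ‖klPairAmplitude L M β U μ K₂ n Q k k'‖ ≤ A₄)
    (hZ : ∀ t ∈ Set.Icc (0 : ℝ) 1, effPartitionFn ℂ (normalCovariance L M s₀ + ((t : ℂ)) • (normalCovariance L M s₁ - normalCovariance L M s₀))
      (hubbardInteraction L M β U + counterQuadratic L M β K₁) ≠ 0)
    (hN6 : ∀ t ∈ Set.Icc (0 : ℝ) 1, ∀ A : HubbardFieldIdx L M,
      ‖kernel ℂ (effAction ℂ (normalCovariance L M s₀ + ((t : ℂ)) • (normalCovariance L M s₁ - normalCovariance L M s₀))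
        (hubbardInteraction L M β U + counterQuadratic L M β K₁)) 6
        (Fin.snoc (Fin.snoc ![(((omega0 M, k'), 0), 0), ((((omega0 M).rev, Q - k'), 1), 0), ((((omega0 M).rev, Q - k), 1), 1),
          (((omega0 M, k), 0), 1)] (A.1, 1 - A.2) : Fin 5 → HubbardFieldIdx L M) A)‖ ≤ N₆)
    (hS : ∀ t ∈ Set.Icc (0 : ℝ) 1, ∀ i : Fin 4,
      |nambuXiCT L μ K₁ ((![(((omega0 M, k'), 0), 0), ((((omega0 M).rev, Q - k'), 1), 0), ((((omega0 M).rev, Q - k), 1), 1), (((omega0 M, k), 0), 1)] :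
              Fin 4 → HubbardFieldIdx L M) i).1.1.2| < 5 * klScale klE0 n / 4 →
      ‖kernel ℂ (effAction ℂ (normalCovariance L M s₀ + ((t : ℂ)) • (normalCovariance L M s₁ - normalCovariance L M s₀))
        (hubbardInteraction L M β U + counterQuadratic L M β K₁)) 2
        ![((((![(((omega0 M, k'), 0), 0), ((((omega0 M).rev, Q - k'), 1), 0), ((((omega0 M).rev, Q - k), 1), 1), (((omega0 M, k), 0), 1)] :
              Fin 4 → HubbardFieldIdx L M) i).1,
            1 - ((![(((omega0 M, k'), 0), 0), ((((omega0 M).rev, Q - k'), 1), 0), ((((omega0 M).rev, Q - k), 1), 1), (((omega0 M, k), 0), 1)] :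
              Fin 4 → HubbardFieldIdx L M) i).2) : HubbardFieldIdx L M),
          (![(((omega0 M, k'), 0), 0), ((((omega0 M).rev, Q - k'), 1), 0), ((((omega0 M).rev, Q - k), 1), 1), (((omega0 M, k), 0), 1)] :
              Fin 4 → HubbardFieldIdx L M) i]‖ ≤ S)
    (hN4 : ∀ t ∈ Set.Icc (0 : ℝ) 1,
      ‖kernel ℂ (effAction ℂ (normalCovariance L M s₀ + ((t : ℂ)) • (normalCovariance L M s₁ - normalCovariance L M s₀))
        (hubbardInteraction L M β U + counterQuadratic L M β K₁)) 4
        ![(((omega0 M, k'), 0), 0), ((((omega0 M).rev, Q - k'), 1), 0), ((((omega0 M).rev, Q - k), 1), 1), (((omega0 M, k), 0), 1)]‖ ≤ N₄) (hS0 : 0 ≤ S) :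
    ‖klPairAmplitude L M β U μ K₂ n Q k k' - klPairAmplitude L M β U μ K₁ n Q k k'‖ ≤
      (6075 / 2 * A₄ / klScale klE0 n +
        24 * (|β| * (L : ℝ) ^ 2) ^ 3 * (30 * σ₁ * N₆ + 8 * (β * (L : ℝ) ^ 2 * (200 + 200 * B₁) / klScale klE0 n ^ 2) * S * N₄)) *
        frameDist K₂ K₁ := by
  have hΛ : 0 < klScale klE0 n := klth_klScale_pos n
  have hL : (0 : ℝ) < L := by exact_mod_cast NeZero.pos L
  have hfd0 : 0 ≤ frameDist K₂ K₁ := frameDist_nonneg K₂ K₁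
  have hA4 : 0 ≤ A₄ := (norm_nonneg _).trans hC4
  set X : Fin 4 → HubbardFieldIdx L M := ![(((omega0 M, k'), 0), 0), ((((omega0 M).rev, Q - k'), 1), 0), ((((omega0 M).rev, Q - k), 1), 1), (((omega0 M, k), 0), 1)] with hX
  set N₄' : ℝ := ‖kernel ℂ (effAction ℂ (normalCovariance L M s₁) (hubbardInteraction L M β U + counterQuadratic L M β K₁)) 4 X‖ with hN4'def
  have hker := norm_kernel_four_klEffectiveAction_frame_sub_le_shell (L := L) (M := M) hβ hB0 hB U μ K₁ K₂ n hfd hZ₂ hs₀ hs₁ hσ X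
    (N₄' := N₄') le_rfl hZ hN6 hS hN4 hS0
  have hund := norm_kernel_four_mismatchResummed_le (L := L) (M := M) hβ U μ K₁ K₂ n hZ₂ X
  have h81 := one_add_two_mul_div_pow_four_le hΛ hfd0 hfd
  have hT : 24 * (|β| * (L : ℝ) ^ 2) ^ 3 * ‖kernel ℂ (klEffectiveAction L M β U μ K₂ klE0 n) 4 X‖ = ‖klPairAmplitude L M β U μ K₂ n Q k k'‖ := by
    rw [klPairAmplitude_eq_const_mul_kernel, norm_mul, norm_pairAmplitude_const]
  have hN4'le : 24 * (|β| * (L : ℝ) ^ 2) ^ 3 * N₄' ≤ 81 / 16 * A₄ := by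
    have h1 : N₄' ≤ (1 + 2 * frameDist K₂ K₁ / klScale klE0 n) ^ 4 * ‖kernel ℂ (klEffectiveAction L M β U μ K₂ klE0 n) 4 X‖ := by
      rw [hN4'def, hs₁]; exact hund
    calc 24 * (|β| * (L : ℝ) ^ 2) ^ 3 * N₄'
        ≤ 24 * (|β| * (L : ℝ) ^ 2) ^ 3 * ((1 + 2 * frameDist K₂ K₁ / klScale klE0 n) ^ 4 * ‖kernel ℂ (klEffectiveAction L M β U μ K₂ klE0 n) 4 X‖) := by
          gcongr
      _ = (1 + 2 * frameDist K₂ K₁ / klScale klE0 n) ^ 4 * ‖klPairAmplitude L M β U μ K₂ n Q k k'‖ := by rw [← hT]; ring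
      _ ≤ 81 / 16 * A₄ := mul_le_mul h81 hC4 (norm_nonneg _) (by norm_num)
  have hpair : ‖klPairAmplitude L M β U μ K₂ n Q k k' - klPairAmplitude L M β U μ K₁ n Q k k'‖ =
      24 * (|β| * (L : ℝ) ^ 2) ^ 3 *
        ‖kernel ℂ (klEffectiveAction L M β U μ K₂ klE0 n) 4 X - kernel ℂ (klEffectiveAction L M β U μ K₁ klE0 n) 4 X‖ := by
    rw [klPairAmplitude_eq_const_mul_kernel, klPairAmplitude_eq_const_mul_kernel, ← mul_sub, norm_mul, norm_pairAmplitude_const]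
  rw [hpair]
  have hc3 : 0 ≤ 24 * (|β| * (L : ℝ) ^ 2) ^ 3 := by positivity
  calc 24 * (|β| * (L : ℝ) ^ 2) ^ 3 *
        ‖kernel ℂ (klEffectiveAction L M β U μ K₂ klE0 n) 4 X - kernel ℂ (klEffectiveAction L M β U μ K₁ klE0 n) 4 X‖
      ≤ 24 * (|β| * (L : ℝ) ^ 2) ^ 3 * (600 * frameDist K₂ K₁ / klScale klE0 n * N₄' +
          (30 * (σ₁ * frameDist K₂ K₁) * N₆ + 8 * (β * (L : ℝ) ^ 2 * (200 + 200 * B₁) / klScale klE0 n ^ 2 * frameDist K₂ K₁) * S * N₄)) :=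
        mul_le_mul_of_nonneg_left hker hc3
    _ = 600 * (24 * (|β| * (L : ℝ) ^ 2) ^ 3 * N₄') / klScale klE0 n * frameDist K₂ K₁ +
          24 * (|β| * (L : ℝ) ^ 2) ^ 3 * (30 * σ₁ * N₆ + 8 * (β * (L : ℝ) ^ 2 * (200 + 200 * B₁) / klScale klE0 n ^ 2) * S * N₄) *
            frameDist K₂ K₁ := by ring
    _ ≤ 600 * (81 / 16 * A₄) / klScale klE0 n * frameDist K₂ K₁ +
          24 * (|β| * (L : ℝ) ^ 2) ^ 3 * (30 * σ₁ * N₆ + 8 * (β * (L : ℝ) ^ 2 * (200 + 200 * B₁) / klScale klE0 n ^ 2) * S * N₄) *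
            frameDist K₂ K₁ := by gcongr
    _ = _ := by ring

end Summit.HubbardSuperconductivity.HubbardSuperconductivity.Theorems.EngineV8

end
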